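import Summits.ResolutionOfSingularities.ResolutionOfSingularities.Theorems.HomologicalConductorNoZenoRFactorStep
import HarnessLib

/-!
# Crux `NoZenoR` (stmt-ResolutionOfSingularities-19943) — the one-step factorisation through a point blow-up, with
# the fibre hypothesis that is actually met (FactorStep′)

Route `ResolutionOfSingularities/HomologicalConductor` (cell decomp-res, hand leafhand-res-homologicalconduct-18 g1).
OURS: AI-written proof over tree theorems, weaker than expert review; nothing here is a statement of the manuscript
under review (Hironaka 2017).  SUPPORT level, counted 0.  Def-free, no new named facts.

Hand 18 g0's `…Lipman12B.exists_fac_blowup_point_of_forall_not_surjective` (Stacks 0C5R, local step) asks, at EVERY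
point `x` of the fibre `u⁻¹(y)`, for a regular local ring OF DIMENSION TWO.  In the case the first-kind clause (F) needs
— `u` contracts a curve onto `y` — the fibre contains the generic point of that curve, whose local ring is a discrete
valuation ring (dimension one), so that hypothesis cannot be met.  Here the three theorems are re-proved with the fibre
hypothesis weakened to «regular of dimension `≤ 2`» (`hX`), which IS what a desingularization of a surface supplies:

* `isPrincipal_map_stalkMap_of_ringKrullDim_le_one` — at a point whose local ring is regular of dimension `≤ 1`
  (a field or a discrete valuation ring, a principal ideal ring by the tree's
  `isPrincipalIdealRing_of_ringKrullDim_le_one`) EVERY extended ideal is principal;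
* `isEffectiveCartier_comap_vanishingIdeal_of_forall_not_surjective'` — `𝔪_y·𝒪_X` is an effective Cartier divisor
  when `y` is a closed point with `𝒪_{Y,y}` regular of dimension `2`, every point over `y` has a regular local ring of
  dimension `≤ 2` and a non-surjective `u♯` (the dimension-two points by hand 18 g0's Abhyankar / Huneke–Swanson key
  lemma `isPrincipal_map_maximalIdeal_stalkMap_of_not_surjective`, the others by the previous bullet), and
  `𝔪_y·𝒪_X ≠ 0`;
* `exists_fac_blowup_point_of_forall_not_surjective'` — hence `u` factors through every blowing up of `Y` at `y`.

No crux or summit statement is proved here.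
-/

noncomputable section

-- single-problem summit: the doubled namespace component `ResolutionOfSingularities` is forced
set_option linter.dupNamespace false

open CategoryTheory AlgebraicGeometry TopologicalSpace IsLocalRing
open Literature.AlgebraicGeometry.Resolution
open Scheme.IdealSheafData

universe u

namespace Summit.ResolutionOfSingularities.ResolutionOfSingularities.Theorems.NoZeno.Lipman12B

/-- Arithmetic in `WithBot ℕ∞` (the values of `ringKrullDim`): `a < 2 → a ≤ 1`. [folklore] -/
theorem withBot_enat_le_one_of_lt_two {a : WithBot ℕ∞} (h : a < 2) : a ≤ 1 := by
  induction a using WithBot.recBotCoe with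
  | bot => exact bot_le
  | coe n =>
    have h' : n < 2 := WithBot.coe_lt_coe.mp (by rwa [WithBot.coe_ofNat])
    have : n ≤ 1 := Order.le_of_lt_add_one (by rwa [one_add_one_eq_two])
    exact WithBot.coe_le_coe.mpr this |>.trans_eq WithBot.coe_one

variable {X Y : Scheme.{u}} (u : X ⟶ Y)

/-- **At a point whose local ring is regular of dimension `≤ 1`, every extended ideal `I·𝒪_{X,x}` is principal**:
such a ring is a field or a discrete valuation ring, in any case a principal ideal ring
(`isPrincipalIdealRing_of_ringKrullDim_le_one`).  This is the case of the generic point of a contracted curve in the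
fibre of a birational morphism of regular surfaces. [cite: StacksProject, Tag 0C5H] -/
theorem isPrincipal_map_stalkMap_of_ringKrullDim_le_one (x : X) [IsRegularLocalRing (X.presheaf.stalk x)]
    (hx1 : ringKrullDim (X.presheaf.stalk x) ≤ 1) (I : Ideal (Y.presheaf.stalk (u.base x))) :
    (I.map (u.stalkMap x).hom).IsPrincipal := by
  haveI := isPrincipalIdealRing_of_ringKrullDim_le_one (R := X.presheaf.stalk x) hx1
  exact IsPrincipalIdealRing.principal _

variable [IsIntegral X] [IsIntegral Y] [IsDominant u]

/-- **`𝔪_y·𝒪_X` is an effective Cartier divisor when no point of the fibre `u⁻¹(y)` has the local ring of `y`** —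
the form whose hypotheses a desingularization of a surface meets: for `u : X → Y` birational dominant between integral
schemes, `X` locally Noetherian, `y` a closed point with `𝒪_{Y,y}` regular of dimension `2`, every point over `y`
having a regular local ring of dimension `≤ 2` and a NON-surjective `u♯`, and `𝔪_y·𝒪_X ≠ 0` — then `𝔪_y·𝒪_X` is
invertible: stalkwise principal at the dimension-two points of the fibre by
`isPrincipal_map_maximalIdeal_stalkMap_of_not_surjective`, at the other points of the fibre by
`isPrincipal_map_stalkMap_of_ringKrullDim_le_one`, the unit ideal off the fibre.
[cite: StacksProject, Tag 0C5H]; [cite: HunekeSwanson2006, Thm. 14.5.2] -/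
theorem isEffectiveCartier_comap_vanishingIdeal_of_forall_not_surjective' [IsLocallyNoetherian X]
    (hu : IsBirational u) {y : Y} (hy : IsClosed ({y} : Set Y)) [IsRegularLocalRing (Y.presheaf.stalk y)]
    (hy2 : ringKrullDim (Y.presheaf.stalk y) = 2)
    (hX : ∀ x : X, u.base x = y → IsRegularLocalRing (X.presheaf.stalk x) ∧ ringKrullDim (X.presheaf.stalk x) ≤ 2)
    (hns : ∀ x : X, u.base x = y → ¬ Function.Surjective (u.stalkMap x))
    (hne : (vanishingIdeal ⟨{y}, hy⟩).comap u ≠ ⊥) :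
    IsEffectiveCartier ((vanishingIdeal ⟨{y}, hy⟩).comap u) := by
  refine Summit.ResolutionOfSingularities.ResolutionOfSingularities.Cruxes.EquisingularLiftNat.Sections.isEffectiveCartier_of_isPrincipal_stalkIdeal_of_ne_bot
    (fun z => ?_) hne
  rw [stalkIdeal_comap_eq_map_stalkMap]
  by_cases hz : u.base z = y
  · subst hz
    obtain ⟨hreg, hz2⟩ := hX z rfl
    haveI := hreg
    rw [stalkIdeal_vanishingIdeal_singleton hy]
    rcases eq_or_ne (ringKrullDim (X.presheaf.stalk z)) 2 with heq | hne2
    · -- a dimension-two point of the fibre: the key lemma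
      obtain ⟨t, -, ht⟩ := isPrincipal_map_maximalIdeal_stalkMap_of_not_surjective u hu z hy2 heq (hns z rfl)
      rw [ht]
      exact ⟨⟨_, rfl⟩⟩
    · -- a point of dimension `≤ 1` (the generic point of a contracted curve): principal ideal ring
      exact isPrincipal_map_stalkMap_of_ringKrullDim_le_one u z
        (withBot_enat_le_one_of_lt_two (lt_of_le_of_ne hz2 hne2)) _
  · -- off the fibre the centre is the unit ideal
    have hz' : u.base z ∉ (vanishingIdeal (⟨{y}, hy⟩ : Closeds Y)).support := by
      rw [← SetLike.mem_coe, Scheme.IdealSheafData.coe_support_vanishingIdeal]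
      exact hz
    rw [stalkIdeal_eq_top_of_not_mem_support hz', Ideal.map_top]
    exact ⟨⟨1, by simp⟩⟩

/-- **One-step factorisation through the point blow-up (FactorStep′)** — the local step of Stacks Tag 0C5R with the
fibre hypothesis a desingularization of a surface meets: under the hypotheses of
`isEffectiveCartier_comap_vanishingIdeal_of_forall_not_surjective'`, `u` factors through every blowing up
`b : Y' → Y` of `Y` at `y` — `u = u' ≫ b` (`IsBlowup.lift`). [cite: StacksProject, Tag 0C5H] -/
theorem exists_fac_blowup_point_of_forall_not_surjective' [IsLocallyNoetherian X]
    (hu : IsBirational u) {y : Y} (hy : IsClosed ({y} : Set Y)) [IsRegularLocalRing (Y.presheaf.stalk y)]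
    (hy2 : ringKrullDim (Y.presheaf.stalk y) = 2)
    (hX : ∀ x : X, u.base x = y → IsRegularLocalRing (X.presheaf.stalk x) ∧ ringKrullDim (X.presheaf.stalk x) ≤ 2)
    (hns : ∀ x : X, u.base x = y → ¬ Function.Surjective (u.stalkMap x))
    (hne : (vanishingIdeal ⟨{y}, hy⟩).comap u ≠ ⊥)
    {Y' : Scheme.{u}} {b : Y' ⟶ Y} (hb : IsBlowup b (vanishingIdeal ⟨{y}, hy⟩)) :
    ∃ u' : X ⟶ Y', u' ≫ b = u :=
  ⟨hb.lift u (isEffectiveCartier_comap_vanishingIdeal_of_forall_not_surjective' u hu hy hy2 hX hns hne),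
    hb.lift_comp u _⟩

end Summit.ResolutionOfSingularities.ResolutionOfSingularities.Theorems.NoZeno.Lipman12B

end
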